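import Summits.QuantumFields.GaugeBoot.HaarShiftStrongCouplingClasses
import HarnessLib

/-!
# At strong coupling the tilted-box Wilson states converge to the unique DLR state (gauge-boot, Class T)

HONEST FRAMING (cell `pub-gaugeboot`, page 1 of every file): the venture produces certified bounds
on lattice expectations at stated coupling, gauge group, dimension and torus size; NOT a mass gap,
NOT a continuum limit, NOT a string tension; NOT Yang–Mills-summit-bearing (barriers
`FixedCouplingUltralocality`, `PerturbativeInvisibility`). STRONG-COUPLING structural statement
(`6(d-1) N |β| < 1`); nothing at the couplings of the cell's certificates.

## Content

`HaarShiftStrongCouplingClasses.lean` showed that at strong coupling the tilted-box limit POINTS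
form the singleton of the unique DLR state. This file upgrades "limit points" to CONVERGENCE:

* `TiltedRP.exists_isTiltedBoxLimitAlong_subseq₂` — compactness (two-sequence form): along ANY two sequences of box
  parameters there is a subsequence along which the transported Wilson states of the square
  45°-tilted boxes `ℤ^d/Γ(M_k + 2, M_k + 2, 2(Q_k + 2))` converge to a tilted limit (every `β`,
  compact metrisable `G`; the proof of `tiltedBoxLimitPoints_nonempty` for general sequences);
* ★★ `TiltedRP.tendsto_integral_tiltedBox_of_small` — for `6(d-1) N |β| < 1`, `M_k → ∞`,
  `Q_k → ∞` (ANY such sequences) and every bounded continuous cylinder observable `F`, the tilted-box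
  expectations `∫ F ∘ tiltedLift dμ_{k,β}` CONVERGE to `∫ F dμ` for every Haar-shift probability
  state `μ` at `β` (the unique DLR state): every subsequence has a sub-subsequence converging to a
  tilted limit point, which is `μ` (`tiltedBoxLimitPoints_eq_singleton_of_small`);
* ★★ `TiltedRP.tendsto_integral_tiltedBox_torus_of_small` — in particular the tilted-box
  expectations and the cubic-torus expectations have the SAME limit at strong coupling
  (`IsHaarShiftState.isInfiniteVolumeLimit_of_small`): for every torus limit point `μ` both the full
  torus sequence and every tilted family converge to `∫ F dμ`.

References: Prokhorov / Riesz–Markov compactness (Mathlib `ProbabilityMeasure` topology);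
R. L. Dobrushin (1968); H.-O. Georgii (2011) Ch. 8; S. Friedli, Y. Velenik (2017) Lemma 6.30.
Folklore.
-/

noncomputable section

open MeasureTheory Filter Topology
open scoped ComplexOrder ComplexConjugate
open Literature.Probability.LatticeModels (Site)
open Literature.MathematicalPhysics.QuantumLattice
open Literature.MathematicalPhysics.QuantumFieldTheory (haarProbability)

namespace Summit.QuantumFields.GaugeBoot

namespace TiltedRP

variable {d N : ℕ} {i j : Fin d} {G : Type} [Group G] [TopologicalSpace G] [IsTopologicalGroup G]
  [CompactSpace G] [MeasurableSpace G] [BorelSpace G] [T2Space G] [SecondCountableTopology G]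
variable (ρ : G →* Matrix (Fin N) (Fin N) ℂ)

/-- **Compactness along arbitrary box families** (two-sequence form of
`exists_isTiltedBoxLimitAlong_subseq` of `TiltedBoxLimitInPlaneRP.lean`, which takes `Q = M`): for any
sequences `M, Q : ℕ → ℕ` there are a strictly increasing `φ : ℕ → ℕ` and a probability measure `μ`
with `IsTiltedBoxLimitAlong d i j ρ β (M ∘ φ) (Q ∘ φ) μ` (the space of probability measures on the
compact metrisable `G^{edges(ℤ^d)}` is sequentially compact). [folklore] -/
theorem exists_isTiltedBoxLimitAlong_subseq₂ (hρ : Continuous ρ) (β : ℝ) (M Q : ℕ → ℕ) :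
    ∃ (φ : ℕ → ℕ) (μ : Measure (LGConfig d G)), StrictMono φ ∧
      IsTiltedBoxLimitAlong d i j ρ β (M ∘ φ) (Q ∘ φ) μ := by
  haveI := fun k : ℕ =>
    isProbabilityMeasure_tiltedState (d := d) i j (M k + 2) (M k + 2) (2 * (Q k + 2)) ρ hρ β
  let P : ℕ → ProbabilityMeasure (LGConfig d G) := fun k =>
    ⟨tiltedState i j (M k + 2) (M k + 2) (2 * (Q k + 2)) ρ β, inferInstance⟩
  obtain ⟨μ, -, φ, hφ, hlim⟩ :=
    (isCompact_univ (X := ProbabilityMeasure (LGConfig d G))).tendsto_subseq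
      fun n => Set.mem_univ (P n)
  refine ⟨φ, (μ : Measure (LGConfig d G)), hφ, inferInstance, fun F S _ hFc hFb => ?_⟩
  obtain ⟨C, hC⟩ := hFb
  let Fb : BoundedContinuousFunction (LGConfig d G) ℝ :=
    BoundedContinuousFunction.ofNormedAddCommGroup F hFc C
      (fun U => by simpa [Real.norm_eq_abs] using hC U)
  have hE : (fun k : ℕ => ∫ U, F (tiltedLift d i j ((M ∘ φ) k + 2) ((M ∘ φ) k + 2)
      (2 * ((Q ∘ φ) k + 2)) U) ∂(gibbs ρ (tiltedUnit d i j ((M ∘ φ) k + 2) ((M ∘ φ) k + 2)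
        (2 * ((Q ∘ φ) k + 2))) β)) =
      fun k => ∫ U, Fb U ∂(P (φ k) : Measure (LGConfig d G)) :=
    funext fun k => (integral_tiltedState i j (M (φ k) + 2) (M (φ k) + 2) (2 * (Q (φ k) + 2)) ρ β
      hFc.measurable).symm
  have key : Tendsto (fun k : ℕ => ∫ U, Fb U ∂(P (φ k) : Measure (LGConfig d G))) atTop
      (𝓝 (∫ U, Fb U ∂(μ : Measure (LGConfig d G)))) :=
    (ProbabilityMeasure.tendsto_iff_forall_integral_tendsto.1 hlim) Fb
  rw [hE]
  exact key

/-- ★★ **At strong coupling the tilted-box Wilson states CONVERGE to the unique DLR state**: for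
`6(d-1) N |β| < 1`, any `M_k → ∞`, `Q_k → ∞`, any Haar-shift probability state `μ` at `β` and every
bounded continuous cylinder observable `F`,
`∫ F(tiltedLift U) dμ_{Γ(M_k+2, M_k+2, 2(Q_k+2)), β}(U) → ∫ F dμ`. [folklore] -/
theorem tendsto_integral_tiltedBox_of_small (hρ : Continuous ρ) {β : ℝ}
    (hβ : 6 * ((d - 1 : ℕ) : ℝ) * N * |β| < 1) {μ : Measure (LGConfig d G)}
    [IsProbabilityMeasure μ] (hμ : IsHaarShiftState ρ β μ) {M Q : ℕ → ℕ}
    (hM : Tendsto M atTop atTop) (hQ : Tendsto Q atTop atTop) {F : LGConfig d G → ℝ}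
    {S : Finset (ZdEdge d)} (hFS : IsCylinder F S) (hFc : Continuous F) (hFb : ∃ C, ∀ U, |F U| ≤ C) :
    Tendsto (fun k : ℕ => ∫ U, F (tiltedLift d i j (M k + 2) (M k + 2) (2 * (Q k + 2)) U)
      ∂(gibbs ρ (tiltedUnit d i j (M k + 2) (M k + 2) (2 * (Q k + 2))) β)) atTop
      (𝓝 (∫ U, F U ∂μ)) := by
  refine tendsto_of_subseq_tendsto fun ns hns => ?_
  obtain ⟨φ, ν, hφ, hν⟩ :=
    exists_isTiltedBoxLimitAlong_subseq₂ (d := d) (i := i) (j := j) ρ hρ β (M ∘ ns) (Q ∘ ns)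
  have hmem : ν ∈ tiltedBoxLimitPoints d i j ρ β :=
    ⟨M ∘ ns ∘ φ, Q ∘ ns ∘ φ, (hM.comp hns).comp hφ.tendsto_atTop,
      (hQ.comp hns).comp hφ.tendsto_atTop, hν⟩
  rw [tiltedBoxLimitPoints_eq_singleton_of_small ρ hρ hβ hμ, Set.mem_singleton_iff] at hmem
  subst hmem
  exact ⟨φ, hν.2 F S hFS hFc hFb⟩

/-- ★★ **Tilted boxes and cubic tori have the same strong-coupling limit**: for `6(d-1) N |β| < 1`
and every infinite-volume limit point `μ` of the cubic torus Wilson states (there is exactly one,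
and the full torus sequence converges to it, `IsHaarShiftState.isInfiniteVolumeLimit_of_small`),
every tilted family `M_k, Q_k → ∞` converges to the same expectations `∫ F dμ`. [folklore] -/
theorem tendsto_integral_tiltedBox_torus_of_small (hρ : Continuous ρ) {β : ℝ}
    (hβ : 6 * ((d - 1 : ℕ) : ℝ) * N * |β| < 1) {μ : Measure (LGConfig d G)}
    (hμ : μ ∈ infiniteVolumeLimitPoints (d := d) ρ β) {M Q : ℕ → ℕ}
    (hM : Tendsto M atTop atTop) (hQ : Tendsto Q atTop atTop) {F : LGConfig d G → ℝ}
    {S : Finset (ZdEdge d)} (hFS : IsCylinder F S) (hFc : Continuous F) (hFb : ∃ C, ∀ U, |F U| ≤ C) :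
    Tendsto (fun k : ℕ => ∫ U, F (tiltedLift d i j (M k + 2) (M k + 2) (2 * (Q k + 2)) U)
      ∂(gibbs ρ (tiltedUnit d i j (M k + 2) (M k + 2) (2 * (Q k + 2))) β)) atTop
      (𝓝 (∫ U, F U ∂μ)) := by
  obtain ⟨L, _, hprob, _⟩ := id hμ
  haveI := hprob
  exact tendsto_integral_tiltedBox_of_small ρ hρ hβ
    (isHaarShiftState_of_mem_infiniteVolumeLimitPoints ρ hρ hμ) hM hQ hFS hFc hFb

end TiltedRP

end Summit.QuantumFields.GaugeBoot
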